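import Summits.AnomalousDissipation.AnomalousDissipation.Theorems.BaireTransferRobustLoudUpgradeLinePolyDefs
import Summits.AnomalousDissipation.AnomalousDissipation.Theorems.BaireTransferRobustLoudUpgradeStubSteadyPersistLeaf
import Summits.AnomalousDissipation.AnomalousDissipation.Theorems.BaireTransferRobustLoudUpgradeStubSteadyWindowLeaf
import Summits.AnomalousDissipation.AnomalousDissipation.Theorems.BaireTransferRobustLoudUpgradeStubEigenFinite
import Summits.AnomalousDissipation.AnomalousDissipation.Theorems.BaireTransferRobustLoudUpgradeStubRealKernel
import Summits.AnomalousDissipation.AnomalousDissipation.Theorems.BaireTransferRobustLoudUpgradeStubSegmentNondeg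
import Summits.AnomalousDissipation.AnomalousDissipation.Theorems.BaireTransferRobustLoudUpgradeStubSegmentSteady
import Summits.AnomalousDissipation.AnomalousDissipation.Theorems.BaireTransferRobustLoudUpgradeStubSegmentBudget
import Summits.AnomalousDissipation.AnomalousDissipation.Theorems.BaireTransferRobustLoudUpgradeStubTruncate
import Summits.AnomalousDissipation.AnomalousDissipation.Theorems.BaireTransferRobustLoudUpgradeLaminarA

/-!
# Line `malkin-cone-group-orbits`, reshape c14: THE POLYNOMIAL-WITNESS CLASS IS TAME and THE STOCK-ENLARGED STEADY UPGRADE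
# (crux `BaireTransfer.RobustLoudUpgrade`, stmt-AnomalousDissipation-1144)

Pure proof file (no definitions) assembling the six stubs of the lead c14 skeleton
(`Cruxes/RobustLoudUpgrade/Lines/malkin_cone_group_orbits_c14.lean`), all landed:
`EigenFinite.stub_eigenFinite` (Riesz–Schauder: a compact operator on a real normed space has finitely many eigenvalues of modulus
`≥ r > 0`), `RealKernel.stub_realKernel` (a complex classical kernel vector of `L(ν,U)`, `U` real, yields a real one),
`SegmentNondeg.stub_segmentNondeg_of` (on the drifted Fourier lattice the linearisation at `t•u₀` is `4π²ν·1 + t·(D+K)`, `D+K` compact: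
finitely many degenerate `t` in `[t₁,t₂]`), `SegmentSteady.stub_segmentSteady` (`t•u₀` is an exact steady state of
`f_{t²c+(t²−t)νe}` when `Δu₀ = f_e`), `SegmentBudget.stub_segmentBudget` (budgets scale by `t²`), `Truncate.stub_truncate` (Fourier
truncation makes every classical steady state an exact polynomial steady state of an enlarged stock, `H¹`- and coefficient-close).

* `polySteady_subset_closure_interior_loud` — **the polynomial steady class is tame**: a loud force carrying an exact
  trigonometric-polynomial steady witness of any mean (`Δu₀ ∈ F_S`, strict budgets) lies in `closure (interior LOUD)` at the SAME budgets,
  with NO visibility, nondegeneracy or symmetry hypothesis — the designer segment of census T1 run INSIDE `P_S`: for `t → 1` off a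
  finite set the force `t²c + (t²−t)νe ∈ nondegSteadyLeaf ⊆ persistSteadyLeaf ⊆ interior LOUD` (landed leaf IFT and leaf window).
  Covers every explicit loud witness in this crux's record (Kolmogorov/shear at all Grashof numbers — previously the dedicated files
  `…LaminarA/B` —, drifted shear flows of `Negative/GalileanDrift`, single-shell cellular and Beltrami/ABC flows) and every seed of the
  census's proposed isola search N-e: polynomial seeds are never wild.
* `tamePoly_subset_closure_interior_loud`, `RobustLoudUpgrade_iff_wild_c14` — the reshape's tame union is force-open up to closure and
  the crux is EQUIVALENT to the wild residual over `tamePoly` (the registered `stub_residual_c14`; census W1 minus finite spectra).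
* `stockEnlarged_steady_upgrade` — **finite-dimensionality is the whole steady obstruction** (census door R3 in the tree's finite
  vocabulary): every force `c ∈ P_S` carrying a classical steady loud witness (`ν < a`, `meanEnergy ≤ E`, `meanDissipation ≥ ε > 0`,
  any mean) is, for every `δ > 0`, within `δ` in an enlarged family `P_{S'}`, `S' ⊇ S`, of an INTERIOR point of
  `LOUD^{(0,a)}(S', 2E, ε/2)`.

References: Foias–Temam 1977 §1, Saut–Temam 1980 §2, Temam 1979 Ch. II §1 (regular points of the steady map); Rudin, *Functional
Analysis* Thm. 4.24–4.25 (Riesz–Schauder); `Cruxes/RobustLoudUpgrade/STRATEGY-CENSUS.md` (T1, W1, R3, N-e); the route file (item 1144).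
-/

-- `Summit.<Summit>.<Problem>` is the tree's mandated summit-side namespace (CONVENTIONS §2); for this
-- single-conjunct summit the two coincide, so the duplicate is deliberate.
set_option linter.dupNamespace false

noncomputable section

open scoped BigOperators Topology
open Filter Set Function TopologicalSpace MeasureTheory

namespace Summit.AnomalousDissipation.AnomalousDissipation.Theorems.RobustLoudUpgrade

open Literature.Analysis.FunctionSpaces Literature.Analysis.FunctionSpaces.Torus
open Literature.Analysis.FluidPDE
open Summit.AnomalousDissipation.AnomalousDissipation.Theses.BaireTransfer
open Summit.AnomalousDissipation.AnomalousDissipation.Theorems.RobustLoudUpgrade.Unfolding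
open Summit.AnomalousDissipation.AnomalousDissipation.Theorems.RobustLoudUpgrade.WildResidual

namespace Poly

/-! ## §1 The polynomial class is tame (assembly of the five landed segment stubs and the landed leaf classes) -/

/-- Finitely many degenerate parameters along the segment (the three kernel stubs composed). [folklore] -/
theorem segmentNondeg_finite {ν : ℝ} (hν : 0 < ν) {u₀ : UnitAddTorus (Fin 3) → EuclideanSpace ℝ (Fin 3)}
    (hu₀ : IsSmooth u₀) (hdiv : IsDivFree u₀) {t₁ : ℝ} (ht₁ : 0 < t₁) (t₂ : ℝ) :
    {t : ℝ | t ∈ Set.Icc t₁ t₂ ∧ Torus.IsLinNSEigenvalue ν (fun x => t • u₀ x) 0}.Finite :=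
  SegmentNondeg.stub_segmentNondeg_of (fun T hT r hr => EigenFinite.stub_eigenFinite T hT r hr)
    RealKernel.stub_realKernel ν u₀ t₁ t₂ hν hu₀ hdiv ht₁

/-- Off the finite degenerate set and inside the strict budget slack, the segment runs in `nondegSteadyLeaf`. [folklore] -/
theorem segment_mem_nondegSteadyLeaf {S : Finset (Fin 3 → ℤ)} {a E ε : ℝ} {c e : Coeff S} {ν : ℝ} (hν : 0 < ν) (hνa : ν < a)
    {u₀ : UnitAddTorus (Fin 3) → EuclideanSpace ℝ (Fin 3)} {p₀ : UnitAddTorus (Fin 3) → ℝ}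
    (hst : Torus.IsSteadyNSState ν (force S c) u₀ p₀) (he : ∀ x, laplacian u₀ x = force S e x) {t : ℝ}
    (hE : t ^ 2 * meanEnergy (fun _ : ℝ => u₀) < E) (hε : ε < t ^ 2 * meanDissipation ν (fun _ : ℝ => u₀))
    (hnd : ¬ Torus.IsLinNSEigenvalue ν (fun x => t • u₀ x) 0) :
    t ^ 2 • c + ((t ^ 2 - t) * ν) • e ∈ nondegSteadyLeaf S a E ε := by
  have hu₀ : IsSmooth u₀ := hst.smooth_velocity.isSmooth_slice (Set.mem_univ 0)
  obtain ⟨hEt, hεt⟩ := SegmentBudget.stub_segmentBudget ν t u₀ hu₀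
  refine ⟨ν, hν, hνa, fun x => t • u₀ x, fun x => t ^ 2 * p₀ x, SegmentSteady.stub_segmentSteady S c e ν u₀ p₀ t hst he, ?_, ?_, hnd⟩
  · rw [hEt]; exact hE
  · rw [hεt]; exact hε

/-- **The polynomial class is tame**: `polySteady ⊆ closure (interior loud)` at the SAME strict budgets — no visibility, nondegeneracy or
symmetry hypothesis (designer segment inside `P_S` + Riesz–Schauder + the landed leaf implicit-function theorem and leaf window).
[folklore] -/
theorem polySteady_subset_closure_interior_loud :
    ∀ (S : Finset (Fin 3 → ℤ)) (a E ε : ℝ), polySteady S a E ε ⊆ closure (interior (loud S a E ε)) := by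
  intro S a E ε c hc
  obtain ⟨ν, hν, hνa, u₀, p₀, hst, hE, hε, e, he⟩ := hc
  have hu₀ : IsSmooth u₀ := hst.smooth_velocity.isSmooth_slice (Set.mem_univ 0)
  have hdiv : IsDivFree u₀ := hst.divFree 0 (Set.mem_univ 0)
  -- the segment of forces and its continuity at `t = 1`
  set γ : ℝ → Coeff S := fun t => t ^ 2 • c + ((t ^ 2 - t) * ν) • e with hγ
  have hγ1 : γ 1 = c := by simp [hγ]
  have hγc : Continuous γ := by
    rw [hγ]
    fun_prop
  -- the finite degenerate set on `[1/2, 2]`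
  set F : Set ℝ := {t : ℝ | t ∈ Set.Icc (1 / 2 : ℝ) 2 ∧ Torus.IsLinNSEigenvalue ν (fun x => t • u₀ x) 0} with hF
  have hFfin : F.Finite := segmentNondeg_finite hν hu₀ hdiv (by norm_num : (0 : ℝ) < 1 / 2) 2
  -- strict budgets persist for `t` near `1`
  set E₀ : ℝ := meanEnergy (fun _ : ℝ => u₀) with hE₀
  set D₀ : ℝ := meanDissipation ν (fun _ : ℝ => u₀) with hD₀
  have hbudget : ∀ᶠ t in 𝓝 (1 : ℝ), t ^ 2 * E₀ < E ∧ ε < t ^ 2 * D₀ := by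
    have h1 : ContinuousAt (fun t : ℝ => t ^ 2 * E₀) 1 := by fun_prop
    have h2 : ContinuousAt (fun t : ℝ => t ^ 2 * D₀) 1 := by fun_prop
    have h1' : ∀ᶠ t in 𝓝 (1 : ℝ), t ^ 2 * E₀ < E :=
      h1.eventually_lt continuousAt_const (by simpa using hE)
    have h2' : ∀ᶠ t in 𝓝 (1 : ℝ), ε < t ^ 2 * D₀ :=
      continuousAt_const.eventually_lt h2 (by simpa using hε)
    exact h1'.and h2'
  -- closeness of `γ t` to `c` for `t` near `1`
  rw [Metric.mem_closure_iff]
  intro r hr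
  have hclose : ∀ᶠ t in 𝓝 (1 : ℝ), dist (γ t) c < r := by
    have h := hγc.continuousAt (x := (1 : ℝ))
    rw [ContinuousAt, hγ1] at h
    exact h (Metric.ball_mem_nhds c hr)
  obtain ⟨η, hη, hball⟩ := Metric.eventually_nhds_iff.1 (hbudget.and hclose)
  -- pick `t ∈ (1, 1 + min η 1) \ F`
  have hinf : (Set.Ioo (1 : ℝ) (1 + min η 1)).Infinite := Set.Ioo_infinite (by simp [hη])
  obtain ⟨t, htI, htF⟩ := (hinf.sdiff hFfin).nonempty
  obtain ⟨ht1, ht2⟩ := htI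
  have htη : dist t 1 < η := by
    rw [Real.dist_eq, abs_of_pos (by linarith)]
    linarith [min_le_left η 1]
  obtain ⟨⟨hEt, hεt⟩, hdist⟩ := hball htη
  have htIcc : t ∈ Set.Icc (1 / 2 : ℝ) 2 := ⟨by linarith, by linarith [min_le_right η 1]⟩
  have hnd : ¬ Torus.IsLinNSEigenvalue ν (fun x => t • u₀ x) 0 := fun h => htF ⟨htIcc, h⟩
  refine ⟨γ t, ?_, by rw [dist_comm]; exact hdist⟩
  have hmem : γ t ∈ nondegSteadyLeaf S a E ε := segment_mem_nondegSteadyLeaf hν hνa hst he hEt hεt hnd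
  exact SteadyWindowLeaf.stub_steadyWindowLeaf S a E ε (SteadyPersistLeaf.stub_steadyPersistLeaf S a E ε hmem)

/-- **The tame union of the reshape c14 is force-open up to closure**: `tamePoly = tameUnfold ∪ polySteady ⊆
closure (interior loud)` at the same strict budgets (the landed glue `tamePoly_subset_closure_interior_loud_of` fed with the
class theorem). [folklore] -/
theorem tamePoly_subset_closure_interior_loud (S : Finset (Fin 3 → ℤ)) (a E ε : ℝ) :
    tamePoly S a E ε ⊆ closure (interior (loud S a E ε)) :=
  tamePoly_subset_closure_interior_loud_of polySteady_subset_closure_interior_loud S a E ε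

/-- **The crux is EQUIVALENT to the c14 residual** (`RobustLoudUpgrade_iff_residual_c14` of the definitions file, now
unconditional): what remains of `RobustLoudUpgrade` after the reshape c14 is exactly the wild residual over `tamePoly`. [folklore] -/
theorem RobustLoudUpgrade_iff_wild_c14 :
    RobustLoudUpgrade ↔
      ∃ S₀ : Finset (Fin 3 → ℤ), ∀ S : Finset (Fin 3 → ℤ), S₀ ⊆ S → ∀ (E ε : ℝ), 0 < ε → ∀ j : ℕ,
        loud S (1 / ((j : ℝ) + 1)) E ε \ closure (tamePoly S (1 / ((j : ℝ) + 1)) (2 * E) (ε / 2)) ⊆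
          closure (interior (loud S (1 / ((j : ℝ) + 1)) (2 * E) (ε / 2))) :=
  RobustLoudUpgrade_iff_residual_c14 polySteady_subset_closure_interior_loud

/-! ## §2 The stock-enlarged steady upgrade (census door R3 in the finite vocabulary) -/

/-- **Stock-enlarged steady upgrade** (census door R3, finite shadow): a force `c ∈ P_S` carrying a classical steady loud witness of
any mean (`meanEnergy ≤ E`, `meanDissipation ≥ ε > 0`, `ν < a`) is, for every `δ > 0`, within `δ` — in some enlarged family `P_{S'}`,
`S' ⊇ S` — of a ROBUSTLY relaxed-loud force of `P_{S'}` (an interior point of `LOUD^{(0,a)}(S', 2E, ε/2)`). [folklore] -/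
theorem stockEnlarged_steady_upgrade :
    ∀ (S : Finset (Fin 3 → ℤ)) (a E ε : ℝ) (c : Coeff S) (ν : ℝ) (u₀ : UnitAddTorus (Fin 3) → EuclideanSpace ℝ (Fin 3))
      (p₀ : UnitAddTorus (Fin 3) → ℝ) (δ : ℝ), 0 < ε → 0 < ν → ν < a → Torus.IsSteadyNSState ν (force S c) u₀ p₀ →
      meanEnergy (fun _ : ℝ => u₀) ≤ E → ε ≤ meanDissipation ν (fun _ : ℝ => u₀) → 0 < δ →
      ∃ S' : Finset (Fin 3 → ℤ), S ⊆ S' ∧ ∃ c'' : Coeff S',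
        dist c'' (fun k => coeffExt S c k) < δ ∧ c'' ∈ interior (loud S' a (2 * E) (ε / 2)) := by
  intro S a E ε c ν u₀ p₀ δ hε hν hνa hst hE hD hδ
  have hsm₀ : IsSmooth u₀ := hst.smooth_velocity.isSmooth_slice (Set.mem_univ (0 : ℝ))
  -- budgets of `u₀` as integrals, with the relaxed strict slack
  set A₀ : ℝ := ∫ x, ‖u₀ x‖ ^ 2 with hA₀
  set G₀ : ℝ := gradNormSq u₀ with hG₀
  have hA : A₀ ≤ E := by rwa [SteadyWindow.meanEnergy_const] at hE
  have hG : ε ≤ ν * G₀ := by rwa [SteadyWindow.meanDissipation_const ν hsm₀] at hD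
  have hA0 : 0 ≤ A₀ := integral_nonneg fun x => by positivity
  have hG0 : 0 ≤ G₀ := gradNormSq_nonneg u₀
  have hGpos : 0 < G₀ := by
    by_contra hle
    push Not at hle
    have hG00 : G₀ = 0 := le_antisymm hle hG0
    rw [hG00, mul_zero] at hG
    exact absurd hG (not_le.2 hε)
  -- a witness with positive dissipation is not identically zero, so its energy is positive
  have hApos : 0 < A₀ := by
    by_contra hle
    push Not at hle
    have hA00 : A₀ = 0 := le_antisymm hle hA0
    have hcont : Continuous u₀ := hsm₀.continuous
    have hint : Integrable (fun x => ‖u₀ x‖ ^ 2) := (hcont.norm.pow 2).integrable_unitAddTorus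
    have hae : (fun x => ‖u₀ x‖ ^ 2) =ᵐ[volume] (fun _ => (0 : ℝ)) :=
      (integral_eq_zero_iff_of_nonneg (fun x => by positivity) hint).1 (by rwa [hA₀] at hA00)
    have hfun : (fun x => ‖u₀ x‖ ^ 2) = fun _ => (0 : ℝ) :=
      (Continuous.ae_eq_iff_eq volume (hcont.norm.pow 2) continuous_const).1 hae
    have hu0 : u₀ = 0 := by
      funext x
      have h := congrFun hfun x
      simpa using h
    have hzero : G₀ = 0 := by
      rw [hG₀, hu0]
      simp [gradNormSq, Torus.partialDeriv, Torus.lineDeriv]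
    exact absurd hzero (ne_of_gt hGpos)
  -- the truncation radius
  set δ' : ℝ := min (δ / 2) (min (A₀ / 7) (ε / (13 * ν))) with hδ'
  have hδ'0 : 0 < δ' := lt_min (by positivity) (lt_min (by positivity) (by positivity))
  have hδ'1 : δ' ≤ δ / 2 := min_le_left _ _
  have hδ'2 : δ' ≤ A₀ / 7 := (min_le_right _ _).trans (min_le_left _ _)
  have hδ'3 : δ' ≤ ε / (13 * ν) := (min_le_right _ _).trans (min_le_right _ _)
  obtain ⟨S', hSS', c', e', u', p', hst', he', hdist, hH1⟩ := Truncate.stub_truncate S c ν u₀ p₀ δ' hν hst hδ'0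
  refine ⟨S', hSS', ?_⟩
  have hsm' : IsSmooth u' := hst'.smooth_velocity.isSmooth_slice (Set.mem_univ (0 : ℝ))
  -- split the squared `H¹` distance into its two nonnegative parts
  have hL2 : 0 ≤ ∫ x, ‖u' x - u₀ x‖ ^ 2 := integral_nonneg fun _ => sq_nonneg _
  have hH1' : 0 ≤ gradNormSq (fun x => u' x - u₀ x) := gradNormSq_nonneg _
  have hdist' : (∫ x, ‖u' x - u₀ x‖ ^ 2) + gradNormSq (fun x => u' x - u₀ x) < δ' := hH1
  have hdL : ∫ x, ‖u' x - u₀ x‖ ^ 2 ≤ δ' := by linarith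
  have hdG : gradNormSq (fun x => u' x - u₀ x) ≤ δ' := by linarith
  -- the truncated witness has strict relaxed budgets
  have hEn : meanEnergy (fun _ : ℝ => u') < 2 * E := by
    rw [SteadyWindow.meanEnergy_const]
    have h := SteadyWindow.integral_norm_sq_le hsm₀.continuous hsm'.continuous (by norm_num : (0 : ℝ) < 1 / 2)
    have h7 : (∫ x, ‖u' x - u₀ x‖ ^ 2) ≤ A₀ / 7 := hdL.trans hδ'2
    norm_num at h
    nlinarith
  have hDi : ε / 2 < meanDissipation ν (fun _ : ℝ => u') := by
    rw [SteadyWindow.meanDissipation_const ν hsm']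
    have h := SteadyWindow.gradNormSq_le hsm₀ hsm' (by norm_num : (0 : ℝ) < 1 / 2)
    have h13 : gradNormSq (fun x => u' x - u₀ x) ≤ ε / (13 * ν) := hdG.trans hδ'3
    have h13' : ν * gradNormSq (fun x => u' x - u₀ x) ≤ ε / 13 := by
      calc ν * gradNormSq (fun x => u' x - u₀ x) ≤ ν * (ε / (13 * ν)) := mul_le_mul_of_nonneg_left h13 hν.le
        _ = ε / 13 := by field_simp
    norm_num at h
    have h2 : ν * G₀ ≤ ν * (3 / 2 * gradNormSq u' + 3 * gradNormSq (fun x => u' x - u₀ x)) :=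
      mul_le_mul_of_nonneg_left h hν.le
    nlinarith
  have hc' : c' ∈ polySteady S' a (2 * E) (ε / 2) := ⟨ν, hν, hνa, u', p', hst', hEn, hDi, e', he'⟩
  have hcl := polySteady_subset_closure_interior_loud S' a (2 * E) (ε / 2) hc'
  obtain ⟨c'', hc'', hd''⟩ := Metric.mem_closure_iff.1 hcl (δ / 2) (by positivity)
  refine ⟨c'', ?_, hc''⟩
  calc dist c'' (fun k => coeffExt S c k) ≤ dist c'' c' + dist c' (fun k => coeffExt S c k) := dist_triangle _ _ _
    _ < δ / 2 + δ / 2 := by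
        refine add_lt_add ?_ (lt_of_lt_of_le hdist hδ'1)
        rw [dist_comm]; exact hd''
    _ = δ := by ring

/-! ## §3 Non-vacuity: the laminar witness is polynomial at every Grashof number -/

/-- **The Kolmogorov corner lies in the polynomial class**: for every stock `S ∋ k₀`, amplitude `A`, viscosity `0 < ν < a` and budgets
with `Elam A ν < E`, `ε < εlam A ν`, the laminar coefficient vector `cLam S A` (shear force `f = sh A`, exact steady state
`u = sh (A/(4π²ν))`, `Δu = −4π² u = f_{−4π² • cLam S (A/(4π²ν))}`) belongs to `polySteady S a E ε` — so the class theorem recovers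
`cLam S A ∈ closure (interior loud)` at every Grashof number with no spectral information (compare the wave-4 files `…LaminarA/B`, which
prove the INTERIOR statement from Kolmogorov nondegeneracy). [folklore] -/
theorem cLam_mem_polySteady {S : Finset (Fin 3 → ℤ)} (hS : Laminar.k₀ ∈ S) {A ν a E ε : ℝ} (hν : 0 < ν) (hνa : ν < a)
    (hE : Laminar.Elam A ν < E) (hε : ε < Laminar.εlam A ν) : Laminar.cLam S A ∈ polySteady S a E ε := by
  set r : ℝ := A / (4 * Real.pi ^ 2 * ν) with hr
  refine ⟨ν, hν, hνa, Laminar.sh r, fun _ => 0, Laminar.lam_isClassical hS hν.ne' A, ?_, ?_,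
    (-(4 * Real.pi ^ 2)) • Laminar.cLam S r, fun x => ?_⟩
  · rw [Laminar.meanEnergy_sh]
    simpa [Laminar.Elam, hr] using hE
  · rw [Laminar.meanDissipation_sh]
    simpa [Laminar.εlam, hr] using hε
  · have hf : force S ((-(4 * Real.pi ^ 2)) • Laminar.cLam S r) = (-(4 * Real.pi ^ 2)) • force S (Laminar.cLam S r) :=
      SteadyLattice.projForce_smul _ _
    rw [Laminar.laplacian_sh, hf, Pi.smul_apply, Laminar.force_cLam hS]

end Poly

end Summit.AnomalousDissipation.AnomalousDissipation.Theorems.RobustLoudUpgrade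

end
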